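import Literature.NumberTheory.GaloisCohomology.Howard2004.ResidualTauCohomologyProofs
import Literature.NumberTheory.GaloisCohomology.Howard2004.FiniteSingularTame
import HarnessLib

/-!
# Howard 2004, §1.5: evaluation at `γ ∈ Γ_{K_λ}` of the transported / conjugated classes of `T̄`
# (the dictionary `H¹_f(K_λ, T̄) ≅ T̄` versus the action of `τ`; theorems only)

Topic `NumberTheory/GaloisCohomology/Howard2004`. THEOREMS ONLY: no definition, no named fact, no
instance, no notation, no `sorry`. Cell `pub/bsd-print-x9`, print leaf G87
`Literature.NumberTheory.GaloisCohomology.Howard2004.thm161_dvrKolyvaginBound`; seat `bsd-line-x10b-p1-w5`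
g7 ([EIG-LOC] step 3 of the Lemma 1.5.3 chain).

SOURCE. B. Howard, Compositio Math. **140** (2004) = arXiv:1202.6340: Prop. 1.1.7 «`H¹_f(K_v, T) ≅
T/(Frob_v − 1)T` … given on cocycles by evaluation at the Frobenius automorphism» (p. 5 L129–138);
Lemma 1.5.3 proof «the action of complex conjugation splits `H¹_f(K_ℓ, T̄)` and `H¹_s(K_ℓ, T̄)` each
into one-dimensional eigenspaces by H.5 and the isomorphisms `H¹_f(K_ℓ, T̄) ≅ T̄ ≅ H¹_s(K_ℓ, T̄) ⊗ k^×`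
of Proposition 1.1.7» (p. 10 L12–16); §1.3 (p. 7 L44–48) for the transport.

THE POINT (dictionary for the eigenline brick). At a Kolyvagin prime `Γ_{K_v}` acts trivially on `T̄`,
so classes of `H¹(K_v, T̄)` are continuous homomorphisms and `evalClass … γ` reads them at `γ`
(`FiniteSingularEvaluation`). Under this reading, Howard's transport followed by `θ` — the local
action of `τ` (`InertLocalTauProofs`) — is **`z ↦ θ ∘ ρ̄(δ_v) ∘ z ∘ φ_v`**: NOTE the inner correction
`ρ̄(δ_v)` of the conjugation datum. So on `H¹_f(K_v, T̄) ≅ T̄` (evaluation at an arithmetic Frobenius,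
`evalClass_bijective_unramified`) `τ` acts as the involution `θ ∘ ρ̄(δ_v)` of `T̄` (for the canonical
datum this is `ρ̄_ℚ(Frob_ℓ)`, whose square `ρ̄(Frob_λ)` is trivial), provided `φ_v` carries Frobenius
lifts to Frobenius lifts — and the eigenLINES of Lemma 1.5.3 are those of `θ ∘ ρ̄(δ_v)`, which equal
H.5(a)'s `T̄^±` exactly when `ρ̄(δ_v) = 1` on `T̄` (e.g. for the primes produced by Lemma 1.6.2, whose
Frobenius is `(τσ)` with `σ` acting trivially).

WHAT IS PROVED (general finite place `v`, `Γ_{K_v}` and `Γ_{K_{σ v}}` acting trivially on `T̄`):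
* **`ResidualTau.evalClass_thetaH1_transportH1`**:
  `eval_γ (θ_* (transport_v x')) = θ (ρ̄(δ_v) (eval_{φ_v γ} x'))` for `x' ∈ H¹(K_{σ v}, T̄)`;
* **`ResidualTau.evalClass_localization_semilinearH`**:
  `eval_γ (loc_v (τ_* c)) = θ (ρ̄(δ_v) (eval_{φ_v γ} (loc_{σ v} c)))`;
* `…_of_semilinearH_eq` / `…_of_semilinearH_eq_neg`: for a global `(±)`-eigenclass `c`,
  `± eval_γ (loc_v c) = θ (ρ̄(δ_v) (eval_{φ_v γ} (loc_{σ v} c)))`;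
* `evalClass_localization_apply` (`eval_γ (loc_v [f]) = f (res_v γ)`) and the place cast
  `cast_evalClass_localization` (`h : v = w`).

NOT HERE: «`φ_v` maps Frobenius lifts to Frobenius lifts» (true for `ConjugationDatum.ofLifts`), the
eigenlines themselves, `H¹_s`; `thm161_dvrKolyvaginBound` is NOT proved; no summit statement is proved;
the Birch–Swinnerton-Dyer conjecture is not proved by any of this.
References: [Howard2004HeegnerKolyvagin] Prop. 1.1.7, §1.3, Lemma 1.5.3; [MazurRubinMemoirs2004] Lemma 1.2.1.
-/

set_option autoImplicit false

noncomputable section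

open Function NumberField IsDedekindDomain Field
open scoped NumberField ContRepresentation

namespace Literature.NumberTheory.GaloisCohomology.Howard2004

open Literature.NumberTheory.GaloisRepresentations
open Literature.NumberTheory.GaloisRepresentations.DiscreteGaloisModule
open Literature.NumberTheory.EllipticCurves

variable {K : Type} [Field K] [NumberField K] {Nbar : Type} [AddCommGroup Nbar]
  [TopologicalSpace Nbar] [DiscreteTopology Nbar]

/-! ## §1 Evaluation of localized global classes, and the place cast -/

/-- `eval_γ (loc_v [f]) = f (res_v γ)`: a localized class evaluated at `γ ∈ Γ_{K_v}` is the global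
cocycle at the image of `γ` in `Γ_K`. [cite: Howard2004HeegnerKolyvagin, Prop. 1.1.7 (arXiv p. 5 L137–138)] -/
theorem evalClass_localization_apply (ρbar : DiscreteGaloisModule K Nbar) (v : HeightOneSpectrum (𝓞 K))
    (htriv : ∀ (σ : absoluteGaloisGroup (v.adicCompletion K)) (x : Nbar), GaloisRep.toLocal v ρbar σ x = x)
    (γ : absoluteGaloisGroup (v.adicCompletion K)) (f : contOneCocycles ρbar.toTopRep) :
    evalClass (GaloisRep.toLocal v ρbar) htriv γ
        (galoisCohomology.localization ρbar (Sum.inr v) 1 (oneCocycleClass _ f)) =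
      f.1 (absGaloisRestrict K (v.adicCompletion K) γ) := by
  have hloc : galoisCohomology.localization ρbar (Sum.inr v) 1 (oneCocycleClass _ f) =
      oneCocycleClass (ρbar.toLocal (Sum.inr v)).toTopRep
        (contOneCocycles.pullback (absGaloisRestrict K (Place.Completion (Sum.inr v)))
          (X := ρbar.toTopRep) (Y := (ρbar.toLocal (Sum.inr v)).toTopRep)
          (TopRep.ofHom ⟨ContinuousLinearMap.id ℤ Nbar, fun _ => rfl⟩) f) :=
    map_oneCocycleClass _ _ _ f
  rw [hloc]
  exact evalClass_oneCocycleClass (GaloisRep.toLocal v ρbar) htriv γ _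

/-- The place cast along `h : v = w` commutes with evaluation of localized classes.
[cite: Howard2004HeegnerKolyvagin, §1.3 (arXiv p. 7 L44–48, read at `λ̄ = λ`)] -/
theorem cast_evalClass_localization (ρbar : DiscreteGaloisModule K Nbar) {v w : HeightOneSpectrum (𝓞 K)}
    (h : v = w)
    (htv : ∀ (σ : absoluteGaloisGroup (v.adicCompletion K)) (x : Nbar), GaloisRep.toLocal v ρbar σ x = x)
    (htw : ∀ (σ : absoluteGaloisGroup (w.adicCompletion K)) (x : Nbar), GaloisRep.toLocal w ρbar σ x = x)
    (γ : absoluteGaloisGroup (v.adicCompletion K)) (c : galoisCohomology ρbar 1) :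
    evalClass (GaloisRep.toLocal w ρbar) htw (h ▸ γ : absoluteGaloisGroup (w.adicCompletion K))
        (galoisCohomology.localization ρbar (Sum.inr w) 1 c) =
      evalClass (GaloisRep.toLocal v ρbar) htv γ (galoisCohomology.localization ρbar (Sum.inr v) 1 c) := by
  subst h
  rfl

/-! ## §2 Evaluation of `θ_* ∘ transport_v` and of `loc_v ∘ τ_*` -/

namespace ResidualTau

variable {R : Type} [CommRing R] [Module R Nbar] {cd : ConjugationDatum K} {ρbar : DiscreteGaloisModule K Nbar}

/-- **`eval_γ (θ_* (transport_v x')) = θ (ρ̄(δ_v) (eval_{φ_v γ} x'))`**: Howard's transport followed by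
`θ`, read through evaluation (trivial local actions at `v` and `σ v`), is `z ↦ θ ∘ ρ̄(δ_v) ∘ z ∘ φ_v` —
the inner correction `δ_v` of the datum acts on the VALUES.
[cite: Howard2004HeegnerKolyvagin, §1.3 (arXiv p. 7 L44–48) with Prop. 1.1.7 (p. 5 L137–138)] -/
theorem evalClass_thetaH1_transportH1 (A : ResidualTau (R := R) cd ρbar) (v : HeightOneSpectrum (𝓞 K))
    (htriv : ∀ (σ : absoluteGaloisGroup (v.adicCompletion K)) (x : Nbar), GaloisRep.toLocal v ρbar σ x = x)
    (htriv' : ∀ (σ : absoluteGaloisGroup ((cd.σ • v).adicCompletion K)) (x : Nbar),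
      GaloisRep.toLocal (cd.σ • v) ρbar σ x = x)
    (γ : absoluteGaloisGroup (v.adicCompletion K))
    (x' : galoisCohomology (ρbar.toLocal (Sum.inr (cd.σ • v))) 1) :
    evalClass (GaloisRep.toLocal v ρbar) htriv γ (A.thetaH1 (Sum.inr v) (cd.transportH1 ρbar v x')) =
      A.θ (ρbar (cd.δ v) (evalClass (GaloisRep.toLocal (cd.σ • v) ρbar) htriv' (cd.φ v γ) x')) := by
  obtain ⟨z, rfl⟩ := oneCocycleClass_surjective _ x'
  have hθ : ∀ χ : contOneCocycles ((cd.twist ρbar).toLocal (Sum.inr v)).toTopRep,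
      A.thetaH1 (Sum.inr v) (oneCocycleClass _ χ) = oneCocycleClass _
        (contOneCocycles.pullback (ContinuousMonoidHom.id _)
          (X := ((cd.twist ρbar).toLocal (Sum.inr v)).toTopRep)
          (Y := (ρbar.toLocal (Sum.inr v)).toTopRep)
          (TopRep.ofHom ⟨⟨A.θ.toAddMonoidHom.toIntLinearMap, continuous_of_discreteTopology⟩,
            fun g => ContinuousLinearMap.ext fun x =>
              A.compat (absGaloisRestrict K (Place.Completion (Sum.inr v)) g) x⟩) χ) :=
    fun χ => map_oneCocycleClass _ _ _ χ
  rw [ConjugationDatum.transportH1_oneCocycleClass]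
  have e1 := congrArg (evalClass (GaloisRep.toLocal v ρbar) htriv γ)
    (hθ (contOneCocycles.pullback (cd.φ v) (cd.transportHom ρbar v) z))
  refine e1.trans ?_
  have e2 : evalClass (GaloisRep.toLocal (cd.σ • v) ρbar) htriv' (cd.φ v γ)
      (oneCocycleClass (ρbar.toLocal (Sum.inr (cd.σ • v))).toTopRep z) = z.1 (cd.φ v γ) :=
    evalClass_oneCocycleClass _ htriv' _ z
  rw [e2]
  exact evalClass_oneCocycleClass (GaloisRep.toLocal v ρbar) htriv γ _

/-- **`eval_γ (loc_v (τ_* c)) = θ (ρ̄(δ_v) (eval_{φ_v γ} (loc_{σ v} c)))`** for a global class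
`c ∈ H¹(K, T̄)`: localizing the global action of `τ` and reading at `γ`.
[cite: Howard2004HeegnerKolyvagin, §1.3 H.5 (arXiv p. 7 L93–97) with Prop. 1.1.7 (p. 5 L137–138)] -/
theorem evalClass_localization_semilinearH (A : ResidualTau (R := R) cd ρbar)
    (v : HeightOneSpectrum (𝓞 K))
    (htriv : ∀ (σ : absoluteGaloisGroup (v.adicCompletion K)) (x : Nbar), GaloisRep.toLocal v ρbar σ x = x)
    (htriv' : ∀ (σ : absoluteGaloisGroup ((cd.σ • v).adicCompletion K)) (x : Nbar),
      GaloisRep.toLocal (cd.σ • v) ρbar σ x = x)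
    (γ : absoluteGaloisGroup (v.adicCompletion K)) (c : galoisCohomology ρbar 1) :
    evalClass (GaloisRep.toLocal v ρbar) htriv γ (galoisCohomology.localization ρbar (Sum.inr v) 1
        (semilinearH cd.isLift A.θ.toAddMonoidHom A.isSemilinear 1 c)) =
      A.θ (ρbar (cd.δ v) (evalClass (GaloisRep.toLocal (cd.σ • v) ρbar) htriv' (cd.φ v γ)
        (galoisCohomology.localization ρbar (Sum.inr (cd.σ • v)) 1 c))) := by
  rw [A.localization_semilinearH v c]
  exact A.evalClass_thetaH1_transportH1 v htriv htriv' γ _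

/-- For a global `τ`-FIXED class: `eval_γ (loc_v c) = θ (ρ̄(δ_v) (eval_{φ_v γ} (loc_{σ v} c)))`.
[cite: Howard2004HeegnerKolyvagin, Lemma 1.5.3 proof (arXiv p. 10 L12–16)] -/
theorem evalClass_localization_of_semilinearH_eq (A : ResidualTau (R := R) cd ρbar)
    (v : HeightOneSpectrum (𝓞 K))
    (htriv : ∀ (σ : absoluteGaloisGroup (v.adicCompletion K)) (x : Nbar), GaloisRep.toLocal v ρbar σ x = x)
    (htriv' : ∀ (σ : absoluteGaloisGroup ((cd.σ • v).adicCompletion K)) (x : Nbar),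
      GaloisRep.toLocal (cd.σ • v) ρbar σ x = x)
    (γ : absoluteGaloisGroup (v.adicCompletion K)) {c : galoisCohomology ρbar 1}
    (hc : semilinearH cd.isLift A.θ.toAddMonoidHom A.isSemilinear 1 c = c) :
    evalClass (GaloisRep.toLocal v ρbar) htriv γ (galoisCohomology.localization ρbar (Sum.inr v) 1 c) =
      A.θ (ρbar (cd.δ v) (evalClass (GaloisRep.toLocal (cd.σ • v) ρbar) htriv' (cd.φ v γ)
        (galoisCohomology.localization ρbar (Sum.inr (cd.σ • v)) 1 c))) := by
  rw [← A.evalClass_localization_semilinearH v htriv htriv' γ c, hc]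

/-- For a global `τ`-ANTI-fixed class: `-eval_γ (loc_v c) = θ (ρ̄(δ_v) (eval_{φ_v γ} (loc_{σ v} c)))`.
[cite: Howard2004HeegnerKolyvagin, Lemma 1.5.3 proof (arXiv p. 10 L12–16)] -/
theorem evalClass_localization_of_semilinearH_eq_neg (A : ResidualTau (R := R) cd ρbar)
    (v : HeightOneSpectrum (𝓞 K))
    (htriv : ∀ (σ : absoluteGaloisGroup (v.adicCompletion K)) (x : Nbar), GaloisRep.toLocal v ρbar σ x = x)
    (htriv' : ∀ (σ : absoluteGaloisGroup ((cd.σ • v).adicCompletion K)) (x : Nbar),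
      GaloisRep.toLocal (cd.σ • v) ρbar σ x = x)
    (γ : absoluteGaloisGroup (v.adicCompletion K)) {c : galoisCohomology ρbar 1}
    (hc : semilinearH cd.isLift A.θ.toAddMonoidHom A.isSemilinear 1 c = -c) :
    -evalClass (GaloisRep.toLocal v ρbar) htriv γ (galoisCohomology.localization ρbar (Sum.inr v) 1 c) =
      A.θ (ρbar (cd.δ v) (evalClass (GaloisRep.toLocal (cd.σ • v) ρbar) htriv' (cd.φ v γ)
        (galoisCohomology.localization ρbar (Sum.inr (cd.σ • v)) 1 c))) := by
  have h := A.evalClass_localization_semilinearH v htriv htriv' γ c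
  rw [hc, map_neg] at h
  rw [← h]
  exact (map_neg (evalClass (GaloisRep.toLocal v ρbar) htriv γ) _).symm

end ResidualTau

end Literature.NumberTheory.GaloisCohomology.Howard2004
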